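import Literature.MathematicalPhysics.QuantumFieldTheory.Balaban1983to89.B13WalksOfB9FactorsReadingNeumann

/-!
# `Balaban1983to89.B13InverseLettersNeumannRadius` — T. Bałaban, *Propagators for lattice gauge theories in a background field*, Commun.
Math. Phys. **99** (1985) 389–434 [Balaban1985BackgroundPropagators], Sect. B p. 402: «… for α₁ sufficiently small the norm of this operator is small
and I − V′(A)G′(U) is an invertible operator, the inverse is given by a convergent Neumann series» ((3.62)–(3.64); (3.86) p. 407; Thm 3.10
(3.107)–(3.108) p. 416); *Renormalization group approach to lattice gauge field theories. II*, Commun. Math. Phys. **116** (1988) 1–22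
[Balaban1988RG2Cluster] p. 13, p. 15: THE THIN RADIUS OF SECT. B's NEUMANN ROAD AS ONE LOCATED NUMERAL.

Module 58 (`B13InverseLettersNeumann.rawEntryLetters_inv_of_neumann(_torus)`), module 60 (`B13WalksOfB9FactorsReadingNeumann`) and the
member face 58B (`Thm/…N10EntryLettersOfN06RecordFaceC`) display, beside the letters of the un-inverted family `A` (`(R, ρ, B)`), the centre's
right inverse `G₀` (`B_G`) and the fibre bound `m`, FIVE NUMERIC BINDERS — a row-sum rate `hμ : 0 < μ`, `h3μ : 3μ ≤ ρ`, a thin radius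
`hR₁ : 0 < R₁`, `hR₁R : R₁ ≤ R` and print's smallness `hq ∕ hsmall : 2B·R₁∕R·B_G·(m·c₀(1,μ)^ν)² ≤ ½` («α₁ sufficiently small»).  THIS FILE
∃-eliminates them into ONE EXPLICIT located radius: for every target rate `0 ≤ ρ′ < ρ` put `μ := (ρ − ρ′)∕3` and
`R₁⋆ := R ∕ (4·B·B_G·(m·c₀(1,μ)^ν)² + 1)`; then `0 < R₁⋆ ≤ R`, the smallness holds (`2T∕(4T+1) ≤ ½`), and the inverse family `u ↦ A(u)⁻¹`
has letters `(R′, ρ′, 2B_G)` at EVERY radius `0 < R′ ≤ R₁⋆` (module 34 `rawEntryLetters_mono`).  For the N10 junction (module 67's binder `hEL` at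
the rung's chart radius `rf.R`) the five binders of an inverse factor thus become ONE located inequality `rf.R ≤ R₁⋆(letters of the factor)` —
the same move as `B13Bound226Numerals` (`θ₀ ≤ θ₀max`) and `B13CondTowerAccretiveFloor` (`rf.m₀ ≤ m⋆`) on two other binder classes.

statement-level bookkeeping ([folklore] arithmetic + monotonicity of the letter datum) over the landed modules 34 ∕ 58 ∕ 60 with citation tags;
kernel-checked; nothing here is a claim about the Yang–Mills mass gap; nothing of Bałaban's operators is constructed or asserted; no node is
discharged; count-neutral.

WHY THIS FILE (cell `pub-ymgap`, HUMAN RULING D-0062 ∕ D-0149, Track A node N10 = [B13]; width seat `pub-ymgap-dag-n10-w2` g2 on the n10-c lane's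
module-60 lineage; census `N10-RESIDUAL-CENSUS-v15∕v16.md` class «NODE A `hEL` for INVERSE pieces — road 58 ∕ 58B ∕ 60»).
* §1 [folklore] arithmetic of the located radius: `thinRadius_pos`, `thinRadius_le`, ★ `smallness_thinRadius` (in 58's literal product order).
* §2 over 58 §3: `rawEntryLetters_inv_of_neumann_thinRadius` (row sum `C` and rate `μ` kept, radius located); ★★ `rawEntryLetters_inv_of_neumann_torus_located`
  (torus row sum: radius AND rate located — hypotheses `hA h0 hG hBG hfib`, `0 < R`, `0 ≤ ρ′ < ρ` only); `rawEntryLetters_inv_of_neumann_torus_located_of_le`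
  (every `0 < R′ ≤ R₁⋆`; `0 < R′` not even needed).
* §3 over 60: ★ `rawEntryLetters_inv_of_conv3107_neumann_reading_located` (any `g : B9.Geometry`, any located reading, N06's `Conv3107 ∕ Identities310` at
  ONE background, the complexified operator's letters; `0 < R_an`, `0 ≤ ρ′ < δ·sℓ`), `…_reading_located_of_le`, `rawEntryLetters_inv_of_conv3107_neumann_torus_located`
  (identity reading of the torus frame `torusGeom Nf η L M`).
* §4 A2 ∕ A6: `rawEntryLetters_inv_of_neumann_toy_located` — module 58 §4's toy family `(γ+u)·1` (`γ > 0`) reaches EVERY target rate `0 ≤ ρ′ < ρ` at the located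
  radius, with no hand-chosen `R₁` (58 §4 chose `R₁ = γ∕(8(S²+1))` by hand for the one rate `4μ − 3μ`).
HONEST FRAMING: `R₁⋆` is a number of the DISPLAYED letters `(R, B, B_G, m, ν, ρ − ρ′)`; Theorem 3.10 at the centre (N06's `Conv3107 ∕ Identities310` ∕
the right inverse `G₀`), the complexification `hAL ∕ hslice0` (NODE 00 ∕ [II] p. 15) and the located reading stay displayed hypotheses of their owners;
nothing of Bałaban's is constructed or asserted; N06 ∕ N10 NOT discharged; count-neutral; 0 `def`, 0 `sorry`; standard axioms; one finite 𝕋⁴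
programme at fixed ε — nothing continuum ∕ OS ∕ mass gap ∕ Clay.

References: T. Bałaban, CMP 99 (1985) 389–434 [Balaban1985BackgroundPropagators] Sect. B (3.60)–(3.65) p.402, p.403 ll.3–5, (3.86) p.407, Thm 3.10
(3.107)–(3.108) pp.415–416; CMP 116 (1988) 1–22 [Balaban1988RG2Cluster] (2.7) p.13, p.15; CMP 96 (1984) 223–250 [Balaban1984PropagatorsII] Lemma 2.1
(2.61) p.234.
-/

noncomputable section

namespace Literature.MathematicalPhysics.QuantumFieldTheory.Balaban1983to89.B13InverseLettersNeumannRadius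

open Metric Set Finset
open scoped Matrix
open Literature.MathematicalPhysics.QuantumFieldTheory.Balaban1983to89
open Literature.MathematicalPhysics.QuantumFieldTheory.Balaban1983to89.B9Thm37GlueTorus (tdist1 tdist1_nonneg torusGeom len_torusGeom)
open Literature.MathematicalPhysics.QuantumFieldTheory.Balaban1983to89.B5TorusCover (UT)
open Literature.MathematicalPhysics.QuantumFieldTheory.Balaban1983to89.B9Thm310Whole (Ops310 Identities310 Conv3107)
open Literature.MathematicalPhysics.QuantumFieldTheory.Balaban1983to89.B13EntrywiseWalks (RawEntryLetters)
open Literature.MathematicalPhysics.QuantumFieldTheory.Balaban1983to89.B13EntryLetterAlgebra (rawEntryLetters_mono)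
open Literature.MathematicalPhysics.QuantumFieldTheory.Balaban1983to89.B13RealSliceEntryLetters (toyFamily)
open Literature.MathematicalPhysics.QuantumFieldTheory.Balaban1983to89.B13InverseLettersNeumann
  (rawEntryLetters_inv_of_neumann rawEntryLetters_inv_of_neumann_torus rawEntryLetters_toyFamily toy_rightInverse toy_G₀_letters)
open Literature.MathematicalPhysics.QuantumFieldTheory.Balaban1983to89.B13WalksOfB9FactorsReadingNeumann
  (rawEntryLetters_inv_of_conv3107_neumann_reading rawEntryLetters_inv_of_conv3107_neumann_torus)

variable {ν : ℕ} {Nf : Fin ν → ℕ} [∀ i, NeZero (Nf i)]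
variable {E : Type*} [NormedAddCommGroup E] [NormedSpace ℂ E]

/-! ## §1. [folklore] arithmetic of the located thin radius `R ∕ (4·B·B_G·S·S + 1)` -/

section Arith

/-- The located thin radius is positive (`R > 0`, `T ≥ 0`). [folklore] [cite: Balaban1985BackgroundPropagators, (3.62)-(3.64) p.402] -/
theorem thinRadius_pos {R T : ℝ} (hR : 0 < R) (hT : 0 ≤ T) : 0 < R / (4 * T + 1) :=
  div_pos hR (by linarith)

/-- The located thin radius is at most the big radius (`R ≥ 0`, `T ≥ 0`). [folklore] [cite: Balaban1985BackgroundPropagators, (3.62)-(3.64) p.402] -/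
theorem thinRadius_le {R T : ℝ} (hR : 0 ≤ R) (hT : 0 ≤ T) : R / (4 * T + 1) ≤ R :=
  div_le_self hR (by linarith)

/-- ★ **PRINT's «α₁ SUFFICIENTLY SMALL» AS A NUMBER**: at `R₁ := R∕(4·B·B_G·S·S + 1)` module 58's smallness `2·B·R₁∕R·B_G·S·S ≤ ½` holds
(indeed `= 2T∕(4T+1)` with `T = B·B_G·S·S ≥ 0`), stated in 58's literal product order. [folklore]
[cite: Balaban1985BackgroundPropagators, (3.62)-(3.64) p.402, (3.86) p.407; Balaban1984PropagatorsII, Lemma 2.1 (2.61) p.234] -/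
theorem smallness_thinRadius {R B BG S : ℝ} (hR : 0 < R) (hB : 0 ≤ B) (hBG : 0 ≤ BG) (hS : 0 ≤ S) :
    2 * B * (R / (4 * (B * BG * S * S) + 1)) / R * BG * S * S ≤ 1 / 2 := by
  have hT : 0 ≤ B * BG * S * S := mul_nonneg (mul_nonneg (mul_nonneg hB hBG) hS) hS
  have hD : 0 < 4 * (B * BG * S * S) + 1 := by linarith
  have e : 2 * B * (R / (4 * (B * BG * S * S) + 1)) / R * BG * S * S = 2 * (B * BG * S * S) / (4 * (B * BG * S * S) + 1) := by
    field_simp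
  rw [e, div_le_div_iff₀ hD (by norm_num : (0 : ℝ) < 2)]
  nlinarith

end Arith

/-! ## §2. Module 58 §3 with the thin radius (and the rate split) located -/

section Neumann

variable {p : Type} [Fintype p] [DecidableEq p]
variable {A : E → Matrix p p ℂ} {loc : p → UT Nf} {R ρ μ B BG C : ℝ} {m : ℕ} {G₀ : Matrix p p ℂ}

/-- **58 §3 AT THE LOCATED RADIUS** (generic row sum `C` at a given rate `μ`): the binders `hR₁ hR₁R hq` of `rawEntryLetters_inv_of_neumann` are
discharged at `R₁ := R∕(4·B·B_G·(mC)·(mC) + 1)`, given only `0 < R`.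
[cite: Balaban1985BackgroundPropagators, (3.60)-(3.65) p.402, (3.86) p.407, Thm 3.10 (3.107)-(3.108) p.416; Balaban1984PropagatorsII, Lemma 2.1 (2.61) p.234] -/
theorem rawEntryLetters_inv_of_neumann_thinRadius (hA : RawEntryLetters A loc R ρ B) (h0 : A 0 * G₀ = 1)
    (hG : ∀ i j, ‖G₀ i j‖ ≤ BG * Real.exp (-(ρ * tdist1 Nf (loc i) (loc j)))) (hBG : 0 ≤ BG)
    (hfib : ∀ y : UT Nf, (univ.filter fun k => loc k = y).card ≤ m)
    (hμ : 0 ≤ μ) (h3μ : 3 * μ ≤ ρ) (hC : 0 ≤ C)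
    (hrow : ∀ a : UT Nf, ∑ z : UT Nf, Real.exp (-(μ * tdist1 Nf a z)) ≤ C) (hR : 0 < R) :
    RawEntryLetters (fun u => (A u)⁻¹) loc (R / (4 * (B * BG * (m * C) * (m * C)) + 1)) (ρ - 3 * μ) (2 * BG) :=
  have hS : 0 ≤ (m : ℝ) * C := mul_nonneg (Nat.cast_nonneg _) hC
  have hT : 0 ≤ B * BG * (m * C) * (m * C) := mul_nonneg (mul_nonneg (mul_nonneg hA.B_nonneg hBG) hS) hS
  rawEntryLetters_inv_of_neumann hA h0 hG hBG hfib hμ h3μ hC hrow (thinRadius_pos hR hT) (thinRadius_le hR.le hT)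
    (smallness_thinRadius hR hA.B_nonneg hBG hS)

/-- ★★ **SECT. B's ROAD WITH THE THIN RADIUS AND THE RATE SPLIT LOCATED** (torus row sum, every torus size).  Inputs: the letters `(R, ρ, B)` of
`A` on the chart ball, ONE right inverse `G₀` of `A(0)` with (3.108)-letters `B_G` at rate `ρ` (Theorem 3.10 at the centre — its owner's), a fibre
bound `m` of the location map, `0 < R`, and a TARGET RATE `0 ≤ ρ′ < ρ`.  Conclusion: `u ↦ A(u)⁻¹` has letters `(R₁⋆, ρ′, 2B_G)` at the EXPLICIT radius
`R₁⋆ = R ∕ (4·B·B_G·(m·c₀(1,(ρ−ρ′)∕3)^ν)² + 1)` — no `μ`, no `R₁`, no smallness hypothesis.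
[cite: Balaban1985BackgroundPropagators, (3.60)-(3.65) p.402, (3.86) p.407, Thm 3.10 (3.107)-(3.108) p.416; Balaban1984PropagatorsII, Lemma 2.1 (2.61) p.234;
Balaban1988RG2Cluster, p.13, p.15] -/
theorem rawEntryLetters_inv_of_neumann_torus_located (hA : RawEntryLetters A loc R ρ B) (h0 : A 0 * G₀ = 1)
    (hG : ∀ i j, ‖G₀ i j‖ ≤ BG * Real.exp (-(ρ * tdist1 Nf (loc i) (loc j)))) (hBG : 0 ≤ BG)
    (hfib : ∀ y : UT Nf, (univ.filter fun k => loc k = y).card ≤ m) (hR : 0 < R) {ρ' : ℝ} (hρ'0 : 0 ≤ ρ') (hρ' : ρ' < ρ) :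
    RawEntryLetters (fun u => (A u)⁻¹) loc
      (R / (4 * (B * BG * (m * B6.c0 1 ((ρ - ρ') / 3) ^ ν) * (m * B6.c0 1 ((ρ - ρ') / 3) ^ ν)) + 1)) ρ' (2 * BG) := by
  have hμ : 0 < (ρ - ρ') / 3 := by linarith
  have h3μ : 3 * ((ρ - ρ') / 3) ≤ ρ := by
    have e3 : 3 * ((ρ - ρ') / 3) = ρ - ρ' := by ring
    rw [e3]; linarith
  have hS : 0 ≤ (m : ℝ) * B6.c0 1 ((ρ - ρ') / 3) ^ ν := mul_nonneg (Nat.cast_nonneg _) (pow_nonneg (B6RandomWalk.c0_nonneg 1 _) ν)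
  have hT : 0 ≤ B * BG * (m * B6.c0 1 ((ρ - ρ') / 3) ^ ν) * (m * B6.c0 1 ((ρ - ρ') / 3) ^ ν) :=
    mul_nonneg (mul_nonneg (mul_nonneg hA.B_nonneg hBG) hS) hS
  have h := rawEntryLetters_inv_of_neumann_torus hA h0 hG hBG hfib hμ h3μ (thinRadius_pos hR hT) (thinRadius_le hR.le hT)
    (smallness_thinRadius hR hA.B_nonneg hBG hS)
  have e : ρ - 3 * ((ρ - ρ') / 3) = ρ' := by ring
  rw [e] at h
  exact h

/-- **… AT EVERY SMALLER RADIUS** `R′ ≤ R₁⋆` (module 34 `rawEntryLetters_mono`): the form the N10 junction consumes at the rung's chart radius — the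
located inequality `rf.R ≤ R₁⋆`. [cite: Balaban1985BackgroundPropagators, (3.62)-(3.64) p.402, Thm 3.10 (3.108) p.416; Balaban1988RG2Cluster, p.15] -/
theorem rawEntryLetters_inv_of_neumann_torus_located_of_le (hA : RawEntryLetters A loc R ρ B) (h0 : A 0 * G₀ = 1)
    (hG : ∀ i j, ‖G₀ i j‖ ≤ BG * Real.exp (-(ρ * tdist1 Nf (loc i) (loc j)))) (hBG : 0 ≤ BG)
    (hfib : ∀ y : UT Nf, (univ.filter fun k => loc k = y).card ≤ m) (hR : 0 < R) {ρ' : ℝ} (hρ'0 : 0 ≤ ρ') (hρ' : ρ' < ρ) {R' : ℝ}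
    (hR' : R' ≤ R / (4 * (B * BG * (m * B6.c0 1 ((ρ - ρ') / 3) ^ ν) * (m * B6.c0 1 ((ρ - ρ') / 3) ^ ν)) + 1)) :
    RawEntryLetters (fun u => (A u)⁻¹) loc R' ρ' (2 * BG) :=
  rawEntryLetters_mono (rawEntryLetters_inv_of_neumann_torus_located hA h0 hG hBG hfib hR hρ'0 hρ') hR' le_rfl le_rfl

end Neumann

/-! ## §3. Module 60 (the inverse road along a located reading ∕ on the torus frame) with the thin radius and the rate split located -/

section Reading

variable {X : Type} [Fintype X] [DecidableEq X]
variable {g : B9.Geometry} [Fintype g.Site] [DecidableEq g.Site]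
variable {Bg : B9.Backgrounds} {Y ι Aι : Type} [Fintype ι] [Fintype Aι]
variable (𝔬 : Ops310 g Bg X Y ι Aι) {Rr : ℝ} {H : Prop}

omit [DecidableEq g.Site] in
/-- ★ **THE INVERSE ROAD ALONG A READING, THIN RADIUS LOCATED** (60 §1 with `hμ h3μ hR₁ hR₁R hsmall` discharged).  Inputs: N06's `Conv3107 𝔬 R H C δ U₀` and
`Identities310 𝔬 R H U₀` at ONE background; the located reading (`loc`, `sℓ`, `0 ≤ len ≤ ℓ_max`); the complexified operator's letters
`hAL : RawEntryLetters Aop (loc ∘ blk) R_an (δ·sℓ) B_A` with `Aop 0 = M(𝔬.Δa U₀)`; a fibre bound `mX`; `0 < R_an`; a target rate `0 ≤ ρ′ < δ·sℓ`.  Conclusion: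
letters `(R₁⋆, ρ′, 2Cℓ_max²)` of `u ↦ Aop(u)⁻¹` at `R₁⋆ = R_an ∕ (4·B_A·(Cℓ_max²)·(mX·c₀(1,(δsℓ−ρ′)∕3)^ν)² + 1)`.
[cite: Balaban1985BackgroundPropagators, (3.26)–(3.27) p.395, (3.60)–(3.65) p.402, (3.86) p.407, Thm 3.10 (3.107)–(3.108) p.416; Balaban1984PropagatorsII,
Lemma 2.1 (2.61) p.234; Balaban1988RG2Cluster, p.13, p.15] -/
theorem rawEntryLetters_inv_of_conv3107_neumann_reading_located {Aop : E → Matrix X X ℂ} {U₀ : Bg.Cfg}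
    {Ran BA C δ ℓmax sℓ : ℝ} {mX : ℕ}
    (hc : Conv3107 𝔬 Rr H C δ U₀) (hI : Identities310 𝔬 Rr H U₀) (hC : 0 ≤ C) (hδ : 0 ≤ δ)
    (hlen0 : ∀ a : g.Site, 0 ≤ g.len a) (hlen : ∀ a : g.Site, g.len a ≤ ℓmax)
    (loc : g.Site → UT Nf) (hloc : ∀ a b, sℓ * tdist1 Nf (loc a) (loc b) ≤ g.dist a b)
    (hslice0 : Aop 0 = (LinearMap.toMatrix' (𝔬.Δa U₀)).map (algebraMap ℝ ℂ))
    (hAL : RawEntryLetters Aop (loc ∘ 𝔬.blk) Ran (δ * sℓ) BA)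
    (hfibX : ∀ y : UT Nf, (univ.filter fun k => (loc ∘ 𝔬.blk) k = y).card ≤ mX)
    (hRan : 0 < Ran) {ρ' : ℝ} (hρ'0 : 0 ≤ ρ') (hρ' : ρ' < δ * sℓ) :
    RawEntryLetters (fun u => (Aop u)⁻¹) (loc ∘ 𝔬.blk)
      (Ran / (4 * (BA * (C * ℓmax ^ 2) * (mX * B6.c0 1 ((δ * sℓ - ρ') / 3) ^ ν) * (mX * B6.c0 1 ((δ * sℓ - ρ') / 3) ^ ν)) + 1))
      ρ' (2 * (C * ℓmax ^ 2)) := by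
  have hμ : 0 < (δ * sℓ - ρ') / 3 := by linarith
  have h3μ : 3 * ((δ * sℓ - ρ') / 3) ≤ δ * sℓ := by
    have e3 : 3 * ((δ * sℓ - ρ') / 3) = δ * sℓ - ρ' := by ring
    rw [e3]; linarith
  have hS : 0 ≤ (mX : ℝ) * B6.c0 1 ((δ * sℓ - ρ') / 3) ^ ν := mul_nonneg (Nat.cast_nonneg _) (pow_nonneg (B6RandomWalk.c0_nonneg 1 _) ν)
  have hBG : 0 ≤ C * ℓmax ^ 2 := mul_nonneg hC (sq_nonneg _)
  have hT : 0 ≤ BA * (C * ℓmax ^ 2) * (mX * B6.c0 1 ((δ * sℓ - ρ') / 3) ^ ν) * (mX * B6.c0 1 ((δ * sℓ - ρ') / 3) ^ ν) :=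
    mul_nonneg (mul_nonneg (mul_nonneg hAL.B_nonneg hBG) hS) hS
  have h := rawEntryLetters_inv_of_conv3107_neumann_reading 𝔬 hc hI hC hδ hlen0 hlen loc hloc hslice0 hAL hfibX hμ h3μ
    (thinRadius_pos hRan hT) (thinRadius_le hRan.le hT) (smallness_thinRadius hRan hAL.B_nonneg hBG hS)
  have e : δ * sℓ - 3 * ((δ * sℓ - ρ') / 3) = ρ' := by ring
  rw [e] at h
  exact h

omit [DecidableEq g.Site] in
/-- **… at every smaller radius** `R′ ≤ R₁⋆` (the junction's located inequality `rf.R ≤ R₁⋆`).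
[cite: Balaban1985BackgroundPropagators, (3.62)–(3.64) p.402, Thm 3.10 (3.108) p.416; Balaban1988RG2Cluster, p.15] -/
theorem rawEntryLetters_inv_of_conv3107_neumann_reading_located_of_le {Aop : E → Matrix X X ℂ} {U₀ : Bg.Cfg}
    {Ran BA C δ ℓmax sℓ : ℝ} {mX : ℕ}
    (hc : Conv3107 𝔬 Rr H C δ U₀) (hI : Identities310 𝔬 Rr H U₀) (hC : 0 ≤ C) (hδ : 0 ≤ δ)
    (hlen0 : ∀ a : g.Site, 0 ≤ g.len a) (hlen : ∀ a : g.Site, g.len a ≤ ℓmax)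
    (loc : g.Site → UT Nf) (hloc : ∀ a b, sℓ * tdist1 Nf (loc a) (loc b) ≤ g.dist a b)
    (hslice0 : Aop 0 = (LinearMap.toMatrix' (𝔬.Δa U₀)).map (algebraMap ℝ ℂ))
    (hAL : RawEntryLetters Aop (loc ∘ 𝔬.blk) Ran (δ * sℓ) BA)
    (hfibX : ∀ y : UT Nf, (univ.filter fun k => (loc ∘ 𝔬.blk) k = y).card ≤ mX)
    (hRan : 0 < Ran) {ρ' : ℝ} (hρ'0 : 0 ≤ ρ') (hρ' : ρ' < δ * sℓ) {R' : ℝ}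
    (hR' : R' ≤ Ran / (4 * (BA * (C * ℓmax ^ 2) * (mX * B6.c0 1 ((δ * sℓ - ρ') / 3) ^ ν) * (mX * B6.c0 1 ((δ * sℓ - ρ') / 3) ^ ν)) + 1)) :
    RawEntryLetters (fun u => (Aop u)⁻¹) (loc ∘ 𝔬.blk) R' ρ' (2 * (C * ℓmax ^ 2)) :=
  rawEntryLetters_mono (rawEntryLetters_inv_of_conv3107_neumann_reading_located 𝔬 hc hI hC hδ hlen0 hlen loc hloc hslice0 hAL hfibX hRan hρ'0 hρ')
    hR' le_rfl le_rfl

end Reading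

section Torus

variable {X : Type} [Fintype X] [DecidableEq X]
variable {η L M : ℝ}
variable {Bg : B9.Backgrounds} {Y ι Aι : Type} [Fintype ι] [Fintype Aι]
variable (𝔬 : Ops310 (torusGeom Nf η L M) Bg X Y ι Aι) {Rr : ℝ} {H : Prop}

/-- **THE INVERSE ROAD ON THE TORUS FRAME, THIN RADIUS LOCATED** (60 §2 with `hμ h3μ hR₁ hR₁R hsmall` discharged): identity reading of `torusGeom Nf η L M`
(`η ≥ 0`), N06's `Conv3107 ∕ Identities310` at ONE background, the complexified operator's letters `hAL` (rate `δ`) with `Aop 0 = M(Δ_a(U₀))`, a fibre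
bound of `blk`, `0 < R_an`, a target rate `0 ≤ ρ′ < δ` ⟹ letters `(R₁⋆, ρ′, 2Cη²)` of `u ↦ Aop(u)⁻¹`.
[cite: Balaban1985BackgroundPropagators, (3.26)–(3.27) p.395, (3.41) p.397, (3.60)–(3.65) p.402, Thm 3.10 (3.107)–(3.108) p.416; Balaban1988RG2Cluster, p.13, p.15] -/
theorem rawEntryLetters_inv_of_conv3107_neumann_torus_located (hη : 0 ≤ η) {Aop : E → Matrix X X ℂ} {U₀ : Bg.Cfg}
    {Ran BA C δ : ℝ} {mX : ℕ}
    (hc : Conv3107 𝔬 Rr H C δ U₀) (hI : Identities310 𝔬 Rr H U₀) (hC : 0 ≤ C) (hδ : 0 ≤ δ)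
    (hslice0 : Aop 0 = (LinearMap.toMatrix' (𝔬.Δa U₀)).map (algebraMap ℝ ℂ))
    (hAL : RawEntryLetters Aop 𝔬.blk Ran δ BA)
    (hfibX : ∀ y : UT Nf, (univ.filter fun k => 𝔬.blk k = y).card ≤ mX)
    (hRan : 0 < Ran) {ρ' : ℝ} (hρ'0 : 0 ≤ ρ') (hρ' : ρ' < δ) :
    RawEntryLetters (fun u => (Aop u)⁻¹) 𝔬.blk
      (Ran / (4 * (BA * (C * η ^ 2) * (mX * B6.c0 1 ((δ - ρ') / 3) ^ ν) * (mX * B6.c0 1 ((δ - ρ') / 3) ^ ν)) + 1))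
      ρ' (2 * (C * η ^ 2)) := by
  have hμ : 0 < (δ - ρ') / 3 := by linarith
  have h3μ : 3 * ((δ - ρ') / 3) ≤ δ := by
    have e3 : 3 * ((δ - ρ') / 3) = δ - ρ' := by ring
    rw [e3]; linarith
  have hS : 0 ≤ (mX : ℝ) * B6.c0 1 ((δ - ρ') / 3) ^ ν := mul_nonneg (Nat.cast_nonneg _) (pow_nonneg (B6RandomWalk.c0_nonneg 1 _) ν)
  have hBG : 0 ≤ C * η ^ 2 := mul_nonneg hC (sq_nonneg _)
  have hT : 0 ≤ BA * (C * η ^ 2) * (mX * B6.c0 1 ((δ - ρ') / 3) ^ ν) * (mX * B6.c0 1 ((δ - ρ') / 3) ^ ν) :=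
    mul_nonneg (mul_nonneg (mul_nonneg hAL.B_nonneg hBG) hS) hS
  have h := rawEntryLetters_inv_of_conv3107_neumann_torus 𝔬 hη hc hI hC hδ hslice0 hAL hfibX hμ h3μ
    (thinRadius_pos hRan hT) (thinRadius_le hRan.le hT) (smallness_thinRadius hRan hAL.B_nonneg hBG hS)
  have e : δ - 3 * ((δ - ρ') / 3) = ρ' := by ring
  rw [e] at h
  exact h

end Torus

/-! ## §4. NON-VACUITY (A2 ∕ A6): module 58 §4's toy family reaches EVERY target rate at the located radius -/

section Toy

variable {p : Type} [Fintype p] [DecidableEq p]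

/-- ★ **§2 FIRES ON 58's `u`-DEPENDENT TOY** `(γ+u)·1` on `E = ℂ` (`γ > 0`; letters `(γ, ρ, 2γ)` at every rate `ρ`, right inverse `γ⁻¹·1` with letters
`γ⁻¹`, fibre bound `|p|`): for EVERY pair of rates `ρ′ < ρ` the inverse family has letters `(R₁⋆, ρ′, 2γ⁻¹)` at the located radius — no `R₁` chosen by
hand (`0 ≤ ρ′`). [folklore] [cite: Balaban1988RG2Cluster, (2.7) p.13 (toy model, not the paper's operator); Balaban1985BackgroundPropagators, (3.86) p.407] -/
theorem rawEntryLetters_inv_of_neumann_toy_located {γ ρ ρ' : ℝ} (hγ : 0 < γ) (hρ'0 : 0 ≤ ρ') (hρ' : ρ' < ρ) (loc : p → UT Nf) :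
    RawEntryLetters (fun u => (toyFamily (p := p) γ u)⁻¹) loc
      (γ / (4 * ((γ + γ) * γ⁻¹ * ((Fintype.card p : ℝ) * B6.c0 1 ((ρ - ρ') / 3) ^ ν) *
        ((Fintype.card p : ℝ) * B6.c0 1 ((ρ - ρ') / 3) ^ ν)) + 1)) ρ' (2 * γ⁻¹) :=
  rawEntryLetters_inv_of_neumann_torus_located (R := γ) (rawEntryLetters_toyFamily hγ.le hγ.le loc ρ) (toy_rightInverse hγ.ne')
    (toy_G₀_letters hγ loc ρ) (inv_nonneg.2 hγ.le) (fun _ => card_le_univ _) hγ hρ'0 hρ'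

end Toy

end Literature.MathematicalPhysics.QuantumFieldTheory.Balaban1983to89.B13InverseLettersNeumannRadius

end
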